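import Summits.RiemannHypothesis.RiemannHypothesis.Theorems.SemilocalSoninNearVector
import Summits.RiemannHypothesis.RiemannHypothesis.Theorems.SoninBandEnergyBound
import Literature.Analysis.FunctionSpaces.PlancherelL1L2
import HarnessLib

/-!
# The Sonin-space distance lemma at `[−1, 1]`, unconditional (E1 ∧ E2)

Cell `rh-explicit`, seats cc-s2-1 (E2: `SoninDistance*`, `SemilocalSoninNearVector`) and cc-s2-3 (E1:
`SoninBandEnergy*`); lead ruling R5-1 PHASE 1.  This file joins the two:

* `band_energy_bound_Lp_of_fun` — the adapter from a band-energy bound stated for FUNCTIONS (`MemLp f 2`, Fourier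
  integral `𝓕 f`, `∫‖f‖²`, the form of `BandEnergy.integral_norm_sq_fourier_Icc_le`) to the form for CLASSES
  `f ∈ Lp ℂ 2` with Mathlib's `L²` Fourier transform and `‖f‖²` (hypothesis `hband` of the distance lemma), via the
  tree's `L¹ ∩ L²` consistency lemma `Literature.Analysis.FunctionSpaces.fourier_toLp_ae_eq_fourierIntegral`;
* **`SoninDistance.exists_mem_soninSpace_one_one_norm_sub_sq_le`** — for every a.e.-even `η ∈ L²(ℝ)` vanishing a.e.
  on `[−1, 1]` there is `ζ` in Connes–Consani's Sonin space `S(1,1)` with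
  `‖η − ζ‖² ≤ (∫_{[−1,1]} |𝓕η|²) / (1 − 0.9999428)` (`= ε · 10⁷/572 ≈ 17483 ε`), and the projection form
  `SoninDistance.norm_sub_soninProjection_one_one_sq_le`; no hypothesis left;
* `not_semilocalSoninIneqOn_of_nearSonin_vector_one` — the near-Sonin-vector refutation criterion of
  `SemilocalSoninNearVector` with the band-energy hypothesis discharged.

Proof-only file (no definitions, no named facts). [folklore]
-/

set_option linter.dupNamespace false  -- the mandated namespace repeats `RiemannHypothesis`

noncomputable section

open MeasureTheory Complex Set FourierTransform
open scoped Real ComplexConjugate InnerProductSpace ENNReal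

namespace Summit.RiemannHypothesis.RiemannHypothesis

open Literature.NumberTheory.LFunctions Literature.NumberTheory.ConnesConsani2021
  Summit.RiemannHypothesis.RiemannHypothesis.BandEnergy Literature.Analysis.FunctionSpaces

namespace SoninDistance

/-! ## Function form ⇒ class form of a band-energy bound -/

/-- An `L²(ℝ)` class vanishing a.e. off a bounded interval is integrable. [folklore] -/
theorem integrable_of_ae_eq_zero_off_Icc {a b : ℝ} (f : Lp ℂ 2 (volume : Measure ℝ))
    (hf0 : ∀ᵐ x : ℝ, x ∉ Icc a b → (f : ℝ → ℂ) x = 0) : Integrable (f : ℝ → ℂ) := by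
  haveI : IsFiniteMeasure ((volume : Measure ℝ).restrict (Icc a b)) :=
    ⟨by rw [Measure.restrict_apply_univ]; exact measure_Icc_lt_top⟩
  have hOn : IntegrableOn (f : ℝ → ℂ) (Icc a b) :=
    ((Lp.memLp f).restrict (Icc a b)).integrable one_le_two
  exact hOn.integrable_of_ae_notMem_eq_zero hf0

/-- **Adapter (function form ⇒ class form).**  A band-energy bound for functions `f : ℝ → ℂ` in `L²` vanishing a.e.
off `[−α, α]`, stated with the Fourier integral `𝓕 f` and `∫‖f‖²`, yields the bound for classes `f ∈ Lp ℂ 2` with the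
`L²` Fourier transform and `‖f‖²` — the hypothesis `hband` of `exists_mem_soninSpace_norm_sub_sq_le`. [folklore] -/
theorem band_energy_bound_Lp_of_fun {α β Λ : ℝ}
    (h : ∀ f : ℝ → ℂ, MemLp f 2 (volume : Measure ℝ) → (∀ᵐ x : ℝ, x ∉ Icc (-α) α → f x = 0) →
      ∫ x in Icc (-β) β, ‖𝓕 f x‖ ^ 2 ≤ Λ * ∫ x, ‖f x‖ ^ 2)
    (f : Lp ℂ 2 (volume : Measure ℝ)) (hf0 : ∀ᵐ x : ℝ, x ∉ Icc (-α) α → (f : ℝ → ℂ) x = 0) :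
    ∫ x in Icc (-β) β, ‖((𝓕 f : Lp ℂ 2 (volume : Measure ℝ)) : ℝ → ℂ) x‖ ^ 2 ≤ Λ * ‖f‖ ^ 2 := by
  have h2 : MemLp (f : ℝ → ℂ) 2 (volume : Measure ℝ) := Lp.memLp f
  have h1 : Integrable (f : ℝ → ℂ) := integrable_of_ae_eq_zero_off_Icc f hf0
  have hF : ((𝓕 (h2.toLp (f : ℝ → ℂ)) : Lp ℂ 2 (volume : Measure ℝ)) : ℝ → ℂ) =ᵐ[volume]
      𝓕 (f : ℝ → ℂ) := fourier_toLp_ae_eq_fourierIntegral h1 h2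
  rw [Lp.toLp_coeFn f h2] at hF
  have hint : ∫ x in Icc (-β) β, ‖((𝓕 f : Lp ℂ 2 (volume : Measure ℝ)) : ℝ → ℂ) x‖ ^ 2 =
      ∫ x in Icc (-β) β, ‖𝓕 (f : ℝ → ℂ) x‖ ^ 2 := by
    refine integral_congr_ae (ae_restrict_of_ae ?_)
    filter_upwards [hF] with x hx
    rw [hx]
  have hnorm : ‖f‖ ^ 2 = ∫ x, ‖(f : ℝ → ℂ) x‖ ^ 2 := by
    rw [← norm_toLp_sq h2, Lp.toLp_coeFn f h2]
  rw [hint, hnorm]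
  exact h _ h2 hf0

/-! ## The unconditional distance lemma at `[−1, 1]` -/

/-- **Distance to Sonin's space `S(1,1)`, unconditional**: for every a.e.-even `η ∈ L²(ℝ)` vanishing a.e. on
`[−1, 1]` there is `ζ ∈ S(1,1)` with `‖η − ζ‖² ≤ (∫_{[−1,1]} |𝓕 η|²) / (1 − 9999428/10⁷)`.  E2
(`exists_mem_soninSpace_norm_sub_sq_le`) with the band-energy constant of E1
(`BandEnergy.integral_norm_sq_fourier_Icc_le`, seat cc-s2-3). [folklore] -/
theorem exists_mem_soninSpace_one_one_norm_sub_sq_le (η : Lp ℂ 2 (volume : Measure ℝ))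
    (hev : η ∈ evenPart) (hvan : η ∈ vanishOn 1) :
    ∃ ζ ∈ soninSpace 1 1,
      ‖η - ζ‖ ^ 2 ≤ (∫ x in Icc (-1 : ℝ) 1, ‖((𝓕 η : Lp ℂ 2 (volume : Measure ℝ)) : ℝ → ℂ) x‖ ^ 2)
        / (1 - 9999428 / 10000000) :=
  exists_mem_soninSpace_norm_sub_sq_le (α := 1) (β := 1) (Λ := 9999428 / 10000000) (by norm_num) (by norm_num)
    (fun f hf => band_energy_bound_Lp_of_fun (α := 1) (β := 1)
      (fun g hg hg0 => integral_norm_sq_fourier_Icc_le hg hg0) f hf) η hev hvan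

/-- The same with a round constant: `‖η − ζ‖² ≤ 17483 · ∫_{[−1,1]} |𝓕 η|²`. [folklore] -/
theorem exists_mem_soninSpace_one_one_norm_sub_sq_le' (η : Lp ℂ 2 (volume : Measure ℝ))
    (hev : η ∈ evenPart) (hvan : η ∈ vanishOn 1) :
    ∃ ζ ∈ soninSpace 1 1,
      ‖η - ζ‖ ^ 2 ≤ 17483 * ∫ x in Icc (-1 : ℝ) 1, ‖((𝓕 η : Lp ℂ 2 (volume : Measure ℝ)) : ℝ → ℂ) x‖ ^ 2 := by
  obtain ⟨ζ, hζ, h⟩ := exists_mem_soninSpace_one_one_norm_sub_sq_le η hev hvan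
  refine ⟨ζ, hζ, h.trans ?_⟩
  have h0 : 0 ≤ ∫ x in Icc (-1 : ℝ) 1, ‖((𝓕 η : Lp ℂ 2 (volume : Measure ℝ)) : ℝ → ℂ) x‖ ^ 2 :=
    integral_nonneg fun _ => by positivity
  rw [div_le_iff₀ (by norm_num)]
  nlinarith [h0]

/-- **Projection form**: `‖η − 𝐒η‖² ≤ (∫_{[−1,1]} |𝓕 η|²) / (1 − 9999428/10⁷)` for the orthogonal projection
`𝐒 = soninProjection 1 1` onto `S(1,1)`. [folklore] -/
theorem norm_sub_soninProjection_one_one_sq_le (η : Lp ℂ 2 (volume : Measure ℝ))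
    (hev : η ∈ evenPart) (hvan : η ∈ vanishOn 1) :
    ‖η - soninProjection 1 1 η‖ ^ 2 ≤
      (∫ x in Icc (-1 : ℝ) 1, ‖((𝓕 η : Lp ℂ 2 (volume : Measure ℝ)) : ℝ → ℂ) x‖ ^ 2)
        / (1 - 9999428 / 10000000) :=
  norm_sub_soninProjection_sq_le (α := 1) (β := 1) (Λ := 9999428 / 10000000) (by norm_num) (by norm_num)
    (fun f hf => band_energy_bound_Lp_of_fun (α := 1) (β := 1)
      (fun g hg hg0 => integral_norm_sq_fourier_Icc_le hg hg0) f hf) η hev hvan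

end SoninDistance

/-! ## The near-Sonin-vector refutation criterion, band-energy hypothesis discharged -/

/-- **Refutation of `SemilocalSoninIneqOn p a` from a near-Sonin vector, unconditional form** of
`not_semilocalSoninIneqOn_of_nearSonin_vector` (E1's constant `Λ = 9999428/10⁷` plugged in): `η` a.e. even,
vanishing a.e. on `[−1,1]`, `∫_{[−1,1]}|𝓕η|² ≤ ε`, `ε/(1 − 9999428/10⁷) ≤ d²`, `0 ≤ d < ‖η‖`, and the certificate
inequality `C·(G + 4(2N + d)d) < B − K(2N + d)d` for a smooth `g` with CC's two conditions on `[−a, a]`.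
[folklore] -/
theorem not_semilocalSoninIneqOn_of_nearSonin_vector_one (p : ℕ) [Fact p.Prime] {a : ℝ} {g : ℝ → ℂ}
    (hg : IsWeilTest g) (hsupp : tsupport g ⊆ Icc (-a) a)
    (h1 : mulFourier g (I / 2) = 0) (h0 : mulFourier g 0 = 0)
    {η : Lp ℂ 2 (volume : Measure ℝ)} (hev : η ∈ evenPart) (hvan : η ∈ vanishOn 1)
    {ε d B G N C K : ℝ}
    (hε : ∫ x in Icc (-1 : ℝ) 1, ‖((𝓕 η : Lp ℂ 2 (volume : Measure ℝ)) : ℝ → ℂ) x‖ ^ 2 ≤ ε)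
    (hdε : ε / (1 - 9999428 / 10000000) ≤ d ^ 2) (hd0 : 0 ≤ d) (hdη : d < ‖η‖)
    (hB : B ≤ (soninTraceForm (twistKernel p (weilConv g (weilReflect g))) (η : ℝ → ℂ)).re)
    (hG : ‖primeTwist p η‖ ^ 2 ≤ G) (hN : ‖η‖ ≤ N)
    (hC : (archW (weilConv g (weilReflect g))
      - weilSemilocalPrimeTerm {p} (weilConv g (weilReflect g))).re ≤ C) (hC0 : 0 ≤ C)
    (hK : ∫ τ, ‖twistKernel p (weilConv g (weilReflect g)) τ‖ ≤ K)
    (hineq : C * (G + 4 * ((2 * N + d) * d)) < B - K * ((2 * N + d) * d)) :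
    ¬ SemilocalSoninIneqOn p a :=
  not_semilocalSoninIneqOn_of_nearSonin_vector p hg hsupp h1 h0 hev hvan (Λ := 9999428 / 10000000)
    (by norm_num) (by norm_num)
    (fun f hf => SoninDistance.band_energy_bound_Lp_of_fun (α := 1) (β := 1)
      (fun g hg hg0 => BandEnergy.integral_norm_sq_fourier_Icc_le hg hg0) f hf)
    hε hdε hd0 hdη hB hG hN hC hC0 hK hineq

end Summit.RiemannHypothesis.RiemannHypothesis
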